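import Literature.NumberTheory.Automorphic.ResiduallyRegularOrbitalIntegral
import Literature.NumberTheory.Automorphic.GLnResiduallyRegularConjugacy
import Literature.NumberTheory.Automorphic.GLnResiduallyRegularCentralizerCompactCore
import Literature.NumberTheory.Automorphic.UnitaryResiduallyRegularOrbitalIntegral
import HarnessLib

/-!
# The residually-regular unit orbital integral on `GL_n`, HYPOTHESIS-FREE:
`O_γ(1_K) = vol(K) ∕ vol(G_γ ∩ K)` and `= 1` for canonical measures, for `γ ∈ GL_n(𝒪_E)` with
residually separable characteristic polynomial
(Kottwitz, *Base change for unit elements of Hecke algebras* (1986), Prop. 7.1, Cor. 7.3; Laumon,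
*Cohomology of Drinfeld modular varieties* I (1996), Lemma (5.3.2); Rogawski (1990), §4.9 p. 54,
§4.3 p. 43)

Topic `NumberTheory/Automorphic`; namespace `Literature.NumberTheory.Automorphic`. THEOREMS ONLY (no
definition, no instance, no named fact, no `sorry`). The CLOSED form of ★ `ResiduallyRegularOrbitalIntegral`
(road letter «D-S3i»): there the orbital reading was stated under the binders `hK1` (single `K`-class)
and `hcore` (`G_γ ∩ K = compactCore G_γ`); both are THEOREMS of ★ `GLnResiduallyRegularConjugacy` (c3)
`GLn.forall_exists_mem_glInt_conj_eq_of_isConj` and ★ `GLnResiduallyRegularCentralizerCompactCore` (c4)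
`GLn.setOf_mem_glInt_eq_compactCore_centralizer` (B-p14, «D-S3c») for `γ ∈ GL_n(𝒪_E)` whose
REDUCED matrix has separable characteristic polynomial (Kottwitz's residually-regular hypothesis;
`IntegralReduction.redMat`). Substituting them gives the same heads with the binders shrunk to
`(hγ : γ ∈ glInt n E) (hsep : (redMat γ).charpoly.Separable)` (and, on the compact-core heads, the
separability of `charpoly γ` itself, `hγs`, as (c4) carries it):

* `GLn.lintegral_descConj_indicator_glInt_eq_of_separable_redMat`,
  **`GLn.orbitalIntegral_indicator_glInt_eq_of_separable_redMat`** — `O_γ^{ν/t}(1_K) = (ν(K) ∕ t(G_γ ∩ K)).toReal`;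
* **`GLn.orbitalIntegral_indicator_glInt_eq_one_of_separable_redMat`** — `= 1` at `ν(K) = t(G_γ ∩ K) = 1`;
* `GLn.orbitalIntegral_indicator_glInt_eq_of_separable_redMat_of_compactCore` — `= ν(K).toReal` for
  the canonically normalised `t` (`t(compactCore G_γ) = 1`);
* **`GLn.classOrbitalIntegral_indicator_glInt_eq_of_isCanonical_of_separable_redMat`** (`_eq_one_…`)
  — for a CANONICAL orbital measure family: `Φ(⟦γ⟧, 1_K) = ν(K).toReal`, `= 1` at `ν(K) = 1` —
  Kottwitz's unit-element value at the residually regular classes (Cor. 7.3); and its `ℂ`-valued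
  form `GLn.classOrbitalIntegral_indicator_complex_glInt_eq_one_of_isCanonical_of_separable_redMat`
  (the test function `1_K : G → ℂ` of the transfer letters), over ★
  `UnitaryResiduallyRegularOrbitalIntegral.classOrbitalIntegral_indicator_complex_eq_one_of_single_conjClass_of_isCanonical`.

## References

* R. E. Kottwitz, *Base change for unit elements of Hecke algebras*, Compositio Math. 60 (1986),
  Prop. 7.1, Cor. 7.3 [Kottwitz1986].
* G. Laumon, *Cohomology of Drinfeld Modular Varieties* I (1996), Lemma (5.3.2) p. 136 [Laumon1995].
* J. D. Rogawski, *Automorphic Representations of Unitary Groups in Three Variables* (1990), §4.9 p. 54,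
  §4.3 p. 43 [Rogawski1990].
-/

noncomputable section

open MeasureTheory Measure Topology Set Filter Function
open Literature.MeasureTheory.Group
open Literature.NumberTheory.Automorphic.IntegralReduction
open scoped ENNReal NNReal MatrixGroups

namespace Literature.NumberTheory.Automorphic

section Orbital

variable {E : Type*} [Field E] [ValuativeRel E] [TopologicalSpace E] [IsNonarchimedeanLocalField E]
  {n : ℕ} [MeasurableSpace (GL (Fin n) E)] [BorelSpace (GL (Fin n) E)]
  [SecondCountableTopology (GL (Fin n) E)] [T2Space (GL (Fin n) E)] [LocallyCompactSpace (GL (Fin n) E)]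
  (γ : GL (Fin n) E)
  [MeasurableSpace (GL (Fin n) E ⧸ Subgroup.centralizer ({γ} : Set (GL (Fin n) E)))]
  [BorelSpace (GL (Fin n) E ⧸ Subgroup.centralizer ({γ} : Set (GL (Fin n) E)))]
  [hC : IsClosed ((Subgroup.centralizer ({γ} : Set (GL (Fin n) E)) : Subgroup (GL (Fin n) E)) :
    Set (GL (Fin n) E))]
  (t : Measure ↥(Subgroup.centralizer ({γ} : Set (GL (Fin n) E)))) [t.IsMulLeftInvariant]
  [IsFiniteMeasureOnCompacts t] [t.IsOpenPosMeasure] [t.IsInvInvariant] [SFinite t]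
  (ν : Measure (GL (Fin n) E)) [IsHaarMeasure ν] [ν.IsMulRightInvariant]

/-- **`∫⁻_{G ⧸ G_γ} 1_K(x γ x⁻¹) d(ν/t) = ν(K) ∕ t(G_γ ∩ K)`** for `γ ∈ K = GL_n(𝒪_E)` with residually
separable characteristic polynomial (★ D-S3i (r2) with `hK1 :=` ★ (c3)). [cite: Kottwitz1986, Prop. 7.1, Cor. 7.3] [cite: Laumon1995, Lemma (5.3.2) p. 136] -/
theorem GLn.lintegral_descConj_indicator_glInt_eq_of_separable_redMat (hγ : γ ∈ glInt n E)
    (hsep : (redMat ((γ : GL (Fin n) E) : Matrix (Fin n) (Fin n) E)).charpoly.Separable) :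
    ∫⁻ x, descConj γ (Subgroup.centralizer ({γ} : Set (GL (Fin n) E)))
        (fun _ hg => Subgroup.mem_centralizer_singleton_iff.1 hg)
          (((glInt n E : Subgroup (GL (Fin n) E)) : Set (GL (Fin n) E)).indicator (1 : GL (Fin n) E → ℝ≥0∞)) x
          ∂quotientMeasure (Subgroup.centralizer ({γ} : Set (GL (Fin n) E))) t hC ν =
      ν (glInt n E : Set (GL (Fin n) E)) /
        t {c : ↥(Subgroup.centralizer ({γ} : Set (GL (Fin n) E))) | (c : GL (Fin n) E) ∈ glInt n E} :=
  GLn.lintegral_descConj_indicator_glInt_eq_of_single_conjClass γ t ν hγ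
    (GLn.forall_exists_mem_glInt_conj_eq_of_isConj hγ hsep)

/-- **`O_γ^{ν/t}(1_K) = (ν(K) ∕ t(G_γ ∩ K)).toReal`** for `γ ∈ K = GL_n(𝒪_E)` residually regular —
the unit-element orbital integral at a residually separable class (Kottwitz 1986, Cor. 7.3: «the
`G(F)`-class of `γ` meets `K` in a single `K`-class»), ★ D-S3i (r2) with ★ (c3).
[cite: Kottwitz1986, Prop. 7.1, Cor. 7.3] [cite: Rogawski1990, §4.9 p. 54] -/
theorem GLn.orbitalIntegral_indicator_glInt_eq_of_separable_redMat (hγ : γ ∈ glInt n E)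
    (hsep : (redMat ((γ : GL (Fin n) E) : Matrix (Fin n) (Fin n) E)).charpoly.Separable) :
    orbitalIntegral γ (((glInt n E : Subgroup (GL (Fin n) E)) : Set (GL (Fin n) E)).indicator
        (1 : GL (Fin n) E → ℝ)) (quotientMeasure (Subgroup.centralizer ({γ} : Set (GL (Fin n) E))) t hC ν) =
      (ν (glInt n E : Set (GL (Fin n) E)) /
        t {c : ↥(Subgroup.centralizer ({γ} : Set (GL (Fin n) E))) | (c : GL (Fin n) E) ∈ glInt n E}).toReal :=
  GLn.orbitalIntegral_indicator_glInt_eq_of_single_conjClass γ t ν hγ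
    (GLn.forall_exists_mem_glInt_conj_eq_of_isConj hγ hsep)

/-- **`O_γ^{ν/t}(1_K) = 1`** at `ν(K) = 1`, `t(G_γ ∩ K) = 1`, for `γ ∈ K` residually regular.
[cite: Kottwitz1986, Cor. 7.3] [cite: Rogawski1990, §4.3 p. 43] -/
theorem GLn.orbitalIntegral_indicator_glInt_eq_one_of_separable_redMat (hγ : γ ∈ glInt n E)
    (hsep : (redMat ((γ : GL (Fin n) E) : Matrix (Fin n) (Fin n) E)).charpoly.Separable)
    (hν : ν (glInt n E : Set (GL (Fin n) E)) = 1)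
    (ht : t {c : ↥(Subgroup.centralizer ({γ} : Set (GL (Fin n) E))) | (c : GL (Fin n) E) ∈ glInt n E} = 1) :
    orbitalIntegral γ (((glInt n E : Subgroup (GL (Fin n) E)) : Set (GL (Fin n) E)).indicator
        (1 : GL (Fin n) E → ℝ)) (quotientMeasure (Subgroup.centralizer ({γ} : Set (GL (Fin n) E))) t hC ν) = 1 :=
  GLn.orbitalIntegral_indicator_glInt_eq_one_of_single_conjClass γ t ν hγ
    (GLn.forall_exists_mem_glInt_conj_eq_of_isConj hγ hsep) hν ht

/-- **`O_γ^{ν/t}(1_K) = ν(K).toReal` for the canonically normalised `t`** (`t(compactCore G_γ) = 1`),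
`γ ∈ K` with separable and residually separable characteristic polynomial (★ D-S3i with ★ (c3) and
★ (c4) `G_γ ∩ K = compactCore G_γ`). [cite: Kottwitz1986, Prop. 7.1, Cor. 7.3] [cite: Rogawski1990, §4.3 p. 43] -/
theorem GLn.orbitalIntegral_indicator_glInt_eq_of_separable_redMat_of_compactCore (hγ : γ ∈ glInt n E)
    (hγs : ((γ : GL (Fin n) E) : Matrix (Fin n) (Fin n) E).charpoly.Separable)
    (hsep : (redMat ((γ : GL (Fin n) E) : Matrix (Fin n) (Fin n) E)).charpoly.Separable)
    (ht : t (compactCore ↥(Subgroup.centralizer ({γ} : Set (GL (Fin n) E)))) = 1) :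
    orbitalIntegral γ (((glInt n E : Subgroup (GL (Fin n) E)) : Set (GL (Fin n) E)).indicator
        (1 : GL (Fin n) E → ℝ)) (quotientMeasure (Subgroup.centralizer ({γ} : Set (GL (Fin n) E))) t hC ν) =
      (ν (glInt n E : Set (GL (Fin n) E))).toReal :=
  GLn.orbitalIntegral_indicator_glInt_eq_of_single_conjClass_of_compactCore γ t ν hγ
    (GLn.forall_exists_mem_glInt_conj_eq_of_isConj hγ hsep)
    (GLn.setOf_mem_glInt_eq_compactCore_centralizer hγ hγs hsep) ht

end Orbital

section Canonical

variable {E : Type*} [Field E] [ValuativeRel E] [TopologicalSpace E] [IsNonarchimedeanLocalField E]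
  {n : ℕ} [MeasurableSpace (GL (Fin n) E)] [BorelSpace (GL (Fin n) E)]
  [SecondCountableTopology (GL (Fin n) E)] [T2Space (GL (Fin n) E)] [LocallyCompactSpace (GL (Fin n) E)]
  [∀ γ : GL (Fin n) E, MeasurableSpace (GL (Fin n) E ⧸ Subgroup.centralizer ({γ} : Set (GL (Fin n) E)))]
  [∀ γ : GL (Fin n) E, BorelSpace (GL (Fin n) E ⧸ Subgroup.centralizer ({γ} : Set (GL (Fin n) E)))]
  (ν : Measure (GL (Fin n) E)) [IsHaarMeasure ν] [ν.IsMulRightInvariant]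

/-- **The unit element against a CANONICAL family, hypothesis-free at residually regular classes**:
for `m` canonical for `(P, ν)` and a `P`-class `c` whose representative lies in `K = GL_n(𝒪_E)` with
separable and residually separable characteristic polynomial,
`classOrbitalIntegral m 1_K c = ν(K).toReal` (Kottwitz 1986, Cor. 7.3; ★ D-S3i docking with ★ (c3), ★ (c4)).
[cite: Kottwitz1986, Prop. 7.1, Cor. 7.3] [cite: Rogawski1990, §4.3 p. 43] -/
theorem GLn.classOrbitalIntegral_indicator_glInt_eq_of_isCanonical_of_separable_redMat
    {P : GL (Fin n) E → Prop} {m : OrbitalMeasureFamily (GL (Fin n) E)} (hm : m.IsCanonical P ν)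
    (c : ConjClasses (GL (Fin n) E)) (hPc : P (Quotient.out c))
    (hγ : (Quotient.out c : GL (Fin n) E) ∈ glInt n E)
    (hγs : ((Quotient.out c : GL (Fin n) E) : Matrix (Fin n) (Fin n) E).charpoly.Separable)
    (hsep : (redMat ((Quotient.out c : GL (Fin n) E) : Matrix (Fin n) (Fin n) E)).charpoly.Separable) :
    classOrbitalIntegral m (((glInt n E : Subgroup (GL (Fin n) E)) : Set (GL (Fin n) E)).indicator
        (1 : GL (Fin n) E → ℝ)) c = (ν (glInt n E : Set (GL (Fin n) E))).toReal :=
  GLn.classOrbitalIntegral_indicator_glInt_eq_of_isCanonical ν hm c hPc hγ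
    (GLn.forall_exists_mem_glInt_conj_eq_of_isConj hγ hsep)
    (GLn.setOf_mem_glInt_eq_compactCore_centralizer hγ hγs hsep)

/-- **`classOrbitalIntegral m 1_K c = 1`** for a canonical family at `ν(K) = 1`, at a residually
regular class (same hypotheses) — the unit-element value of the fundamental lemma at the residually
regular classes. [cite: Kottwitz1986, Cor. 7.3] [cite: Laumon1995, Lemma (5.3.2) p. 136] -/
theorem GLn.classOrbitalIntegral_indicator_glInt_eq_one_of_isCanonical_of_separable_redMat
    {P : GL (Fin n) E → Prop} {m : OrbitalMeasureFamily (GL (Fin n) E)} (hm : m.IsCanonical P ν)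
    (c : ConjClasses (GL (Fin n) E)) (hPc : P (Quotient.out c))
    (hγ : (Quotient.out c : GL (Fin n) E) ∈ glInt n E)
    (hγs : ((Quotient.out c : GL (Fin n) E) : Matrix (Fin n) (Fin n) E).charpoly.Separable)
    (hsep : (redMat ((Quotient.out c : GL (Fin n) E) : Matrix (Fin n) (Fin n) E)).charpoly.Separable)
    (hν : ν (glInt n E : Set (GL (Fin n) E)) = 1) :
    classOrbitalIntegral m (((glInt n E : Subgroup (GL (Fin n) E)) : Set (GL (Fin n) E)).indicator
        (1 : GL (Fin n) E → ℝ)) c = 1 :=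
  GLn.classOrbitalIntegral_indicator_glInt_eq_one_of_isCanonical ν hm c hPc hγ
    (GLn.forall_exists_mem_glInt_conj_eq_of_isConj hγ hsep)
    (GLn.setOf_mem_glInt_eq_compactCore_centralizer hγ hγs hsep) hν

/-- **`ℂ`-valued form: `classOrbitalIntegral m (1_K : G → ℂ) c = 1`** for a canonical family at
`ν(K) = 1`, at a residually regular class (same hypotheses) — the test function the transfer /
fundamental-lemma letters integrate is `K.indicator fun _ => (1 : ℂ)` (★ generic
`classOrbitalIntegral_indicator_complex_eq_one_of_single_conjClass_of_isCanonical` with ★ (c3), ★ (c4)).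
[cite: Kottwitz1986, Cor. 7.3] [cite: Rogawski1990, §4.9 Prop. 4.9.1 (b) p. 55] -/
theorem GLn.classOrbitalIntegral_indicator_complex_glInt_eq_one_of_isCanonical_of_separable_redMat
    {P : GL (Fin n) E → Prop} {m : OrbitalMeasureFamily (GL (Fin n) E)} (hm : m.IsCanonical P ν)
    (c : ConjClasses (GL (Fin n) E)) (hPc : P (Quotient.out c))
    (hγ : (Quotient.out c : GL (Fin n) E) ∈ glInt n E)
    (hγs : ((Quotient.out c : GL (Fin n) E) : Matrix (Fin n) (Fin n) E).charpoly.Separable)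
    (hsep : (redMat ((Quotient.out c : GL (Fin n) E) : Matrix (Fin n) (Fin n) E)).charpoly.Separable)
    (hν : ν (glInt n E : Set (GL (Fin n) E)) = 1) :
    classOrbitalIntegral m (((glInt n E : Subgroup (GL (Fin n) E)) : Set (GL (Fin n) E)).indicator
        fun _ => (1 : ℂ)) c = 1 :=
  classOrbitalIntegral_indicator_complex_eq_one_of_single_conjClass_of_isCanonical (glInt n E) ν
    (isOpen_glInt n E) (isCompact_glInt n E) hm c hPc hγ
    (GLn.forall_exists_mem_glInt_conj_eq_of_isConj hγ hsep)
    (GLn.setOf_mem_glInt_eq_compactCore_centralizer hγ hγs hsep) hν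

end Canonical

end Literature.NumberTheory.Automorphic
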